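import Mathlib.Topology.Covering.Basic
import Mathlib.Topology.Connected.Clopen
import HarnessLib

/-!
# A lifted section disconnects a pulled-back covering

Elementary point-set topology behind "a finite étale cover with a section is disconnected". Let
`r : Y → Z` be locally injective (e.g. a covering map, a local homeomorphism), `φ : B → Z` continuous,
and `F : B → Y` a continuous lift of `φ` (`r ∘ F = φ`). Inside the fibre product
`B ×_Z Y = {(b, y) | φ b = r y}` (a subspace of `B × Y`) the graph `{(b, F b)}` of `F` — the image of
the section `b ↦ (b, F b)` — is

* open (`isOpen_setOf_snd_eq_lift`: near `(b₀, F b₀)`, on `F⁻¹(U) × U` with `U ∋ F b₀` a set of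
  injectivity of `r`, a point `(b, y)` of the fibre product has `r y = φ b = r (F b)`, so `y = F b`);
* closed when `Y` is Hausdorff (`isClosed_setOf_snd_eq_lift`: equalizer of `pr₂` and `F ∘ pr₁`);
* hence clopen (`isClopen_setOf_snd_eq_lift`), and the fibre product is **not preconnected** as soon as
  one fibre of `r` over the image of `φ` has a second point (`not_isPreconnected_of_lift`).

The same holds in any space mapping continuously to `B × Y` onto the fibre product through an
embedding (`isClopen_preimage_setOf_snd_eq_lift`), which is how it is applied to the complex points
of a fibre product of schemes `C ×_J J'` (towards
`Literature.AlgebraicGeometry.Motives.isIso_bettiCohomology_map_abelJacobi`: the pull-back to a curve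
`C` of the isogeny `[2] : J' → J'` acquires a section once `f : C → J'` lifts, hence is disconnected).
Everything is proved; no definitions. (Hatcher, *Algebraic Topology*, §1.3, Prop. 1.33–1.34 for the
uniqueness-of-lifts phenomenon this expresses.)
-/

open Set Topology

universe u v w

namespace Literature.Topology.CoveringSpaces

variable {B : Type u} {Y : Type v} {Z : Type w} [TopologicalSpace B] [TopologicalSpace Y]
  (φ : B → Z) (r : Y → Z) (F : B → Y)

/-- **The graph of a lift is open in the fibre product**: for `r` locally injective, `φ`, `F`
continuous with `r ∘ F = φ`, the set of points `(b, y)` of `{φ b = r y}` with `y = F b` is open.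
[folklore] -/
theorem isOpen_setOf_snd_eq_lift (hr : IsLocallyInjective r) (hF : Continuous F)
    (hlift : ∀ b, r (F b) = φ b) :
    IsOpen {e : {p : B × Y // φ p.1 = r p.2} | e.1.2 = F e.1.1} := by
  rw [isOpen_iff_forall_mem_open]
  rintro ⟨⟨b₀, y₀⟩, h₀⟩ (he : y₀ = F b₀)
  obtain ⟨U, hUo, hyU, hinj⟩ := hr y₀
  refine ⟨{e | e.1.1 ∈ F ⁻¹' U ∧ e.1.2 ∈ U}, ?_, ?_, ?_⟩
  · rintro ⟨⟨b, y⟩, hby⟩ ⟨hbU, hyU'⟩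
    change y = F b
    exact hinj hyU' hbU (hby.symm.trans (hlift b).symm)
  · exact ((hUo.preimage hF).preimage (continuous_fst.comp continuous_subtype_val)).inter
      (hUo.preimage (continuous_snd.comp continuous_subtype_val))
  · exact ⟨show F b₀ ∈ U from he ▸ hyU, hyU⟩

/-- The graph of a continuous `F` is closed in the fibre product when `Y` is Hausdorff. [folklore] -/
theorem isClosed_setOf_snd_eq_lift [T2Space Y] (hF : Continuous F) :
    IsClosed {e : {p : B × Y // φ p.1 = r p.2} | e.1.2 = F e.1.1} :=
  isClosed_eq (continuous_snd.comp continuous_subtype_val)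
    (hF.comp (continuous_fst.comp continuous_subtype_val))

/-- **The graph of a lift is clopen in the fibre product** (`r` locally injective, `Y` Hausdorff).
[folklore] -/
theorem isClopen_setOf_snd_eq_lift [T2Space Y] (hr : IsLocallyInjective r) (hF : Continuous F)
    (hlift : ∀ b, r (F b) = φ b) :
    IsClopen {e : {p : B × Y // φ p.1 = r p.2} | e.1.2 = F e.1.1} :=
  ⟨isClosed_setOf_snd_eq_lift φ r F hF, isOpen_setOf_snd_eq_lift φ r F hr hF hlift⟩

/-- **A pulled-back covering with a section is disconnected**: if moreover some fibre of `r` over a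
value `φ b` contains a point other than `F b`, the fibre product `{φ b = r y}` is not preconnected
(the graph of `F` is a clopen subset which is neither empty nor everything). [folklore] -/
theorem not_isPreconnected_of_lift [T2Space Y] (hr : IsLocallyInjective r) (hF : Continuous F)
    (hlift : ∀ b, r (F b) = φ b) {b : B} {y : Y} (hy : r y = φ b) (hne : y ≠ F b) :
    ¬ PreconnectedSpace {p : B × Y // φ p.1 = r p.2} := by
  intro hpc
  have h := (isClopen_iff.mp (isClopen_setOf_snd_eq_lift φ r F hr hF hlift)).resolve_left
    (Set.nonempty_iff_ne_empty.mp ⟨⟨(b, F b), (hlift b).symm⟩, rfl⟩)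
  have : (⟨(b, y), hy.symm⟩ : {p : B × Y // φ p.1 = r p.2}) ∈
      ({e : {p : B × Y // φ p.1 = r p.2} | e.1.2 = F e.1.1} : Set _) := by
    rw [h]; trivial
  exact hne this

/-- **Transport along an embedding onto the fibre product**: if `E` maps to `B × Y` by a continuous
`ι` with values in `{φ b = r y}` which is an embedding, then the preimage
`{e | (ι e).2 = F (ι e).1}` of the graph of the lift is clopen in `E`. [folklore] -/
theorem isClopen_preimage_setOf_snd_eq_lift {E : Type*} [TopologicalSpace E] [T2Space Y]
    (hr : IsLocallyInjective r) (hF : Continuous F) (hlift : ∀ b, r (F b) = φ b) (ι : E → B × Y)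
    (hι : ∀ e, φ (ι e).1 = r (ι e).2) (hcont : Continuous ι) :
    IsClopen {e : E | (ι e).2 = F (ι e).1} := by
  let ι' : E → {p : B × Y // φ p.1 = r p.2} := fun e => ⟨ι e, hι e⟩
  have hι' : Continuous ι' := hcont.subtype_mk _
  exact (isClopen_setOf_snd_eq_lift φ r F hr hF hlift).preimage hι'

end Literature.Topology.CoveringSpaces
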